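import Literature.AlgebraicGeometry.ComplexMultiplication.RosatiInvolutionOverNumberField
import HarnessLib

/-!
# The Rosati involution of a divisor on `B_ℂ` whose Weil pairing is `Aut(ℂ/K)`-EQUIVARIANT: descent to `End⁰_K(B)` and positivity
# (Mumford §20–21; Milne 1986 §16–17) — the «equivariant pairing» edition of ★ `AbelianVarietyRosatiDualDescent` / ★ `RosatiInvolutionOverNumberField` §2

Layer `Literature/AlgebraicGeometry/Motives`, namespaces `Literature.AlgebraicGeometry.Motives.AbelianVariety` (§0–§2) and
`Literature.AlgebraicGeometry.ComplexMultiplication` (§3).  THEOREMS ONLY (+ private point-bookkeeping, [folklore]); no definition, no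
named fact, no instance, no `sorry`.

The tree proves (★ `AbelianVarietyRosatiDualDescent`, p750978; ★ `RosatiInvolutionOverNumberField` §2, p752948): for `B/K`, `K ⊆ ℂ`
countable, and an AMPLE divisor of the special shape `Θ = pr₁^*Θ₀` with `Θ₀` a `K`-RATIONAL divisor of `B`, the Rosati duals of
`K`-endomorphisms are `K`-rational (`exists_baseChange_eq_rosatiDual`) and the Rosati involution is a positive anti-involution of
`End⁰_K(B)` (`exists_isPositiveAntiInvolution_endAlgebra_of_uniformisation`).  `K`-rationality of `Θ₀` enters those proofs at ONE
point: the Galois EQUIVARIANCE of the level Weil pairings `ē_N^Θ(σ r, σ s) = σ (ē_N^Θ(r, s))` (★ `weilPairingLevel_galSmul`, through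
«`(galX τ)^*Θ` is the SAME divisor as `Θ`»).  THIS FILE re-runs the same three proofs for an ARBITRARY ample divisor `Θ` on `B_ℂ` under
that equivariance taken as the HYPOTHESIS `hΘgal` — the only change (token shape = the conclusion of ★ `weilPairingLevel_galSmul` at
`L := ℂ`).  Intended `Θ`: a divisor which is Galois-stable merely up to ALGEBRAIC EQUIVALENCE — e.g. the product of the Riemann theta
divisors of the geometric components of a curve over `K`, a Galois conjugate of a theta divisor being a TRANSLATE while no
`K`-rational divisor in the theta class need exist (Poonen–Stoll 1999, §4) — whose pairing is nevertheless equivariant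
(`ē^{(galX τ)^*Θ} = ē^Θ` composed with the conjugation formula `ē^Θ(σ r, σ s) = σ ē^{(galX σ)^*Θ}(r, s)`).

* §1 `weilPairingLevel_map_galConj_of_forall_of_galEquivariant` — if `f′` is a level adjoint of `(d·f₀)_ℂ` for `ē^Θ`, so is every
  `σ • f′` (★ :256 with `hΘgal` for ★ `weilPairingLevel_galSmul`).
* §2 `galConj_rosatiDual_eq_of_galEquivariant`, **`exists_baseChange_eq_rosatiDual_of_galEquivariant`** — the Rosati dual (for `Θ`) of a
  `K`-endomorphism is `Aut(ℂ/K)`-fixed, hence `K`-rational (★ :350 / :377).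
* §3 **`exists_isPositiveAntiInvolution_endAlgebra_of_uniformisation_of_galEquivariant`** — the Rosati involution of `Θ` is a POSITIVE
  ANTI-INVOLUTION of `End⁰_K(B)`, read in the rational representation as `rosati G` (★ p752948 :230).

Cell `hodgecm-mathlib` (D-0151), crux HLiu418 = stmt-HodgeConjecture-24832, road (P) of the d6 socket `SocketRosZ` (director s211; A-plan2
(g12) 03:11:15Z / 03:21:45Z «pairing-level invariance»): leg (tr-2c) = the upstream of (T3b)'s positivity `hι` and of the descent that
DEFINES the Rosati involution of the canonical polarisation on `End⁰_E(A_K)`.  Count-neutral; HC_CM is proved only modulo the 7 printed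
citations until rung 0 closes.

## References
* [MumfordAV1970] D. Mumford, *Abelian Varieties* (1970), §20 (p. 186 property (3) of `e_n`; p. 189 the Rosati involution), §21 Thm. 1.
* [Milne1986AbelianVarieties] J. S. Milne, *Abelian varieties* (1986), §16 (p. 131, the pairings `ē_m`), §17 (the Rosati involution).
* [Shimura1998] G. Shimura, *Abelian Varieties with Complex Multiplication and Modular Functions* (1998), §1.3, §5.1 Prop. 5 (p. 38).
* [Lang1983AbelianVarieties] S. Lang, *Abelian Varieties*, Ch. VII §2 Props. 2–4.
* [Lange2023AbelianVarietiesComplex] H. Lange, *Abelian Varieties over the Complex Numbers* (2023), §2.4.1 Lemma 2.4.1, Thm. 2.4.9.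
-/

noncomputable section

open CategoryTheory AlgebraicGeometry Complex Cardinal Module
open scoped Matrix Kronecker
open Literature.Geometry.Kaehler Literature.Geometry.Kaehler.ComplexTorus
open Literature.NumberTheory.Transcendental Literature.AlgebraicGeometry.HodgeTheory
open Literature.RingTheory.CentralSimple Literature.NumberTheory.Automorphic

namespace Literature.AlgebraicGeometry.Motives.AbelianVariety

/-! ### §0 Point bookkeeping (private, [folklore]; as in ★ `AbelianVarietyRosatiDualDescent`) -/

/-- The level Weil pairing only depends on the underlying points. [folklore] -/
private theorem weilPairingLevel_congr_points {L : Type} [Field L] {A : AbelianVariety L} {N : ℕ}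
    [IsDominant (Hom.toSchemeHom ((N : ℤ) • 𝟙 A))] (Θ : CartierDivisor A.X.left)
    {P P' Q Q' : A.torsionPoints L N} (hP : (P : A.Points L) = P') (hQ : (Q : A.Points L) = Q') :
    A.weilPairingLevel Θ P Q = A.weilPairingLevel Θ P' Q' := by
  cases Subtype.ext hP
  cases Subtype.ext hQ
  rfl

/-! ### §1 Uniqueness of the level-`N` adjoint on a complex abelian variety -/

section Galois

variable {K : Type} [Field K] [Algebra K ℂ] (B : AbelianVariety K)

/-- `u(x)` is `N`-torsion when `x` is (`u ∈ End(B_ℂ)` acting on `B(ℂ)`). [folklore] -/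
private theorem pointsEnd_pow_eq_one {N : ℕ} (u : End (B.baseChange ℂ)) {x : B.Points ℂ} (hx : x ^ N = 1) :
    B.pointsEnd ℂ u x ^ N = 1 := by
  rw [← map_pow, hx, map_one]

/-- The torsion point of `B_ℂ(ℂ)` attached to `u(x)` is `u` applied to the one attached to `x`. [folklore] -/
private theorem coe_torsionPt_pointsEnd {N : ℕ} (u : End (B.baseChange ℂ)) {x : B.Points ℂ} (hx : x ^ N = 1) :
    ((B.torsionPt ℂ (B.pointsEnd_pow_eq_one u hx) : (B.baseChange ℂ).torsionPoints ℂ N) :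
        (B.baseChange ℂ).Points ℂ) =
      AlgPoints.map u.hom.hom.hom ((B.torsionPt ℂ hx : (B.baseChange ℂ).torsionPoints ℂ N) :
        (B.baseChange ℂ).Points ℂ) := by
  change B.pointsMulEquiv ℂ ((B.pointsMulEquiv ℂ).symm (B.pointsMulEquiv ℂ x ≫ u.hom.hom.hom)) = _
  rw [MulEquiv.apply_symm_apply]
  rfl

/-- … as an equality of torsion points. [folklore] -/
private theorem torsionPt_pointsEnd {N : ℕ} (u : End (B.baseChange ℂ)) {x : B.Points ℂ} (hx : x ^ N = 1) :
    B.torsionPt ℂ (B.pointsEnd_pow_eq_one u hx) =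
      ⟨AlgPoints.map u.hom.hom.hom (B.torsionPt ℂ hx).1, map_mem_torsionPoints u (B.torsionPt ℂ hx).2⟩ :=
  Subtype.ext (B.coe_torsionPt_pointsEnd u hx)

/-- Every `N`-torsion point of `B_ℂ(ℂ)` is the torsion point attached to an `ℂ`-point of `B` with `x ^ N = 1`. [folklore] -/
private theorem symm_pow_eq_one {N : ℕ} (P : (B.baseChange ℂ).torsionPoints ℂ N) :
    (B.pointsMulEquiv ℂ).symm P.1 ^ N = 1 := by
  rw [← map_pow, coe_torsionPoints_pow_eq_one P, map_one]

/-- … namely `torsionPt` of `pointsMulEquiv⁻¹ P`. [folklore] -/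
private theorem torsionPt_symm {N : ℕ} (P : (B.baseChange ℂ).torsionPoints ℂ N) :
    B.torsionPt ℂ (B.symm_pow_eq_one P) = P :=
  Subtype.ext ((B.pointsMulEquiv ℂ).apply_symm_apply P.1)

/-- Two torsion points with the same underlying point are equal. [folklore] -/
private theorem torsionPt_congr {N : ℕ} {x y : B.Points ℂ} (hx : x ^ N = 1) (hy : y ^ N = 1) (h : x = y) :
    B.torsionPt ℂ hx = B.torsionPt ℂ hy := by
  subst h
  rfl

/-- `B(ℂ) ≃ B_ℂ(ℂ)` carries the action of `u ∈ End(B_ℂ)` on `B(ℂ)` (`pointsEnd`) to `P ↦ u P`. [folklore] -/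
private theorem pointsMulEquiv_pointsEnd (u : End (B.baseChange ℂ)) (x : B.Points ℂ) :
    B.pointsMulEquiv ℂ (B.pointsEnd ℂ u x) = AlgPoints.map u.hom.hom.hom (B.pointsMulEquiv ℂ x) :=
  (B.pointsMulEquiv ℂ).apply_symm_apply _

/-- Galois conjugation commutes with integer multiples: `σ • (d • r) = d • (σ • r)`. [folklore] -/
private theorem galConj_zsmul (σ : ℂ ≃ₐ[K] ℂ) (d : ℤ) (r : End (B.baseChange ℂ)) :
    B.galConj ℂ σ (d • r) = d • B.galConj ℂ σ r :=
  map_zsmul (AddMonoidHom.mk' (fun r : End (B.baseChange ℂ) => B.galConj ℂ σ r) (B.galConj_add ℂ σ)) d r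

/-! ### §1 Galois transport of the level adjunction under an EQUIVARIANT pairing -/

/-- **Galois transport of the level adjunction, equivariant-pairing edition** (Milne §16: the `ē_m` are Galois pairings;
Mumford §20 (3)): for a divisor `Θ` on `B_ℂ` whose level pairings are `Aut(ℂ/K)`-equivariant (`hΘgal`), `f = (f₀)_ℂ` for
`f₀ ∈ End(B)`, and `f′ ∈ End(B_ℂ)` with `ē_N^Θ((d·f) P, Q) = ē_N^Θ(P, f′ Q)` for all `N, P, Q`, the Galois conjugate `σ • f′` has the
same property for every `σ ∈ Aut(ℂ/K)` — the proof of ★ `weilPairingLevel_map_galConj_of_forall`, the equivariance hypothesis replacing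
★ `weilPairingLevel_galSmul`. [cite: Milne1986AbelianVarieties, §16 (p. 131, the pairings ē_m)]
[cite: MumfordAV1970, §20 (p. 186, property (3) of e_n)] [cite: Lang1983AbelianVarieties, Ch. VII §2 Props. 2–3] -/
theorem weilPairingLevel_map_galConj_of_forall_of_galEquivariant (Θ : CartierDivisor (B.baseChange ℂ).X.left)
    (hΘgal : ∀ (σ : ℂ ≃ₐ[K] ℂ) {N : ℕ} [IsDominant (Hom.toSchemeHom ((N : ℤ) • 𝟙 (B.baseChange ℂ)))] {r s : B.Points ℂ}
      (hr : r ^ N = 1) (hs : s ^ N = 1),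
      (B.baseChange ℂ).weilPairingLevel Θ (B.torsionPt ℂ (B.smul_pow_eq_one ℂ σ hr)) (B.torsionPt ℂ (B.smul_pow_eq_one ℂ σ hs)) =
        σ ((B.baseChange ℂ).weilPairingLevel Θ (B.torsionPt ℂ hr) (B.torsionPt ℂ hs)))
    (f₀ : End B) (d : ℤ)
    {f' : End (B.baseChange ℂ)}
    (hadj : ∀ (N : ℕ) [IsDominant (Hom.toSchemeHom ((N : ℤ) • 𝟙 (B.baseChange ℂ)))]
      (P Q : (B.baseChange ℂ).torsionPoints ℂ N),
      (B.baseChange ℂ).weilPairingLevel Θ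
          ⟨AlgPoints.map (d • (Hom.baseChange ℂ f₀ : End (B.baseChange ℂ))).hom.hom.hom P.1,
            map_mem_torsionPoints _ P.2⟩ Q =
        (B.baseChange ℂ).weilPairingLevel Θ P
          ⟨AlgPoints.map f'.hom.hom.hom Q.1, map_mem_torsionPoints f' Q.2⟩)
    (σ : ℂ ≃ₐ[K] ℂ) (N : ℕ) [IsDominant (Hom.toSchemeHom ((N : ℤ) • 𝟙 (B.baseChange ℂ)))]
    (P Q : (B.baseChange ℂ).torsionPoints ℂ N) :
    (B.baseChange ℂ).weilPairingLevel Θ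
        ⟨AlgPoints.map (d • (Hom.baseChange ℂ f₀ : End (B.baseChange ℂ))).hom.hom.hom P.1,
          map_mem_torsionPoints _ P.2⟩ Q =
      (B.baseChange ℂ).weilPairingLevel Θ P
        ⟨AlgPoints.map (B.galConj ℂ σ f').hom.hom.hom Q.1, map_mem_torsionPoints (B.galConj ℂ σ f') Q.2⟩ := by
  set f : End (B.baseChange ℂ) := Hom.baseChange ℂ f₀ with hf
  -- `ℂ`-points of `B` underlying `P`, `Q`, and their `σ⁻¹`-translates
  have hr := B.symm_pow_eq_one P
  have hs := B.symm_pow_eq_one Q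
  set e := B.pointsMulEquiv ℂ with he
  set r := e.symm P.1 with hrdef
  set s := e.symm Q.1 with hsdef
  have hr' := B.smul_pow_eq_one ℂ σ⁻¹ hr
  have hs' := B.smul_pow_eq_one ℂ σ⁻¹ hs
  have heP : e r = P.1 := e.apply_symm_apply P.1
  have heQ : e s = Q.1 := e.apply_symm_apply Q.1
  -- `σ` fixes `d • f`
  have hσf : B.galConj ℂ σ (d • f) = d • f := by
    rw [galConj_zsmul, hf, galConj_baseChange]
    rfl
  have k1 : σ • B.pointsEnd ℂ (d • f) (σ⁻¹ • r) = B.pointsEnd ℂ (d • f) r := by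
    rw [← B.pointsEnd_galConj ℂ σ (d • f) r, hσf]
  have k4 : σ • B.pointsEnd ℂ f' (σ⁻¹ • s) = B.pointsEnd ℂ (B.galConj ℂ σ f') s := by
    rw [B.pointsEnd_galConj ℂ σ f' s]
  -- the identity at `(σ⁻¹ r, σ⁻¹ s)`, read on `torsionPt`s
  have h1 : (B.baseChange ℂ).weilPairingLevel Θ
        (B.torsionPt ℂ (B.pointsEnd_pow_eq_one (d • f) hr')) (B.torsionPt ℂ hs') =
      (B.baseChange ℂ).weilPairingLevel Θ
        (B.torsionPt ℂ hr') (B.torsionPt ℂ (B.pointsEnd_pow_eq_one f' hs')) :=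
    (weilPairingLevel_congr_points _ (B.pointsMulEquiv_pointsEnd (d • f) (σ⁻¹ • r)) rfl).trans
      ((hadj N (B.torsionPt ℂ hr') (B.torsionPt ℂ hs')).trans
        (weilPairingLevel_congr_points _ rfl (B.pointsMulEquiv_pointsEnd f' (σ⁻¹ • s)).symm))
  -- conjugate by `σ`
  calc (B.baseChange ℂ).weilPairingLevel Θ
          ⟨AlgPoints.map (d • f).hom.hom.hom P.1, map_mem_torsionPoints _ P.2⟩ Q
      = (B.baseChange ℂ).weilPairingLevel Θ
          (B.torsionPt ℂ (B.smul_pow_eq_one ℂ σ (B.pointsEnd_pow_eq_one (d • f) hr')))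
          (B.torsionPt ℂ (B.smul_pow_eq_one ℂ σ hs')) := by
        refine weilPairingLevel_congr_points _ ?_ ?_
        · change AlgPoints.map (d • f).hom.hom.hom P.1 = e (σ • B.pointsEnd ℂ (d • f) (σ⁻¹ • r))
          rw [k1, pointsMulEquiv_pointsEnd, heP]
        · change Q.1 = e (σ • (σ⁻¹ • s))
          rw [smul_inv_smul, heQ]
    _ = σ ((B.baseChange ℂ).weilPairingLevel Θ
          (B.torsionPt ℂ (B.pointsEnd_pow_eq_one (d • f) hr')) (B.torsionPt ℂ hs')) :=
        hΘgal σ _ _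
    _ = σ ((B.baseChange ℂ).weilPairingLevel Θ
          (B.torsionPt ℂ hr') (B.torsionPt ℂ (B.pointsEnd_pow_eq_one f' hs'))) := by rw [h1]
    _ = (B.baseChange ℂ).weilPairingLevel Θ
          (B.torsionPt ℂ (B.smul_pow_eq_one ℂ σ hr'))
          (B.torsionPt ℂ (B.smul_pow_eq_one ℂ σ (B.pointsEnd_pow_eq_one f' hs'))) :=
        (hΘgal σ _ _).symm
    _ = (B.baseChange ℂ).weilPairingLevel Θ P
          ⟨AlgPoints.map (B.galConj ℂ σ f').hom.hom.hom Q.1, map_mem_torsionPoints (B.galConj ℂ σ f') Q.2⟩ := by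
        refine weilPairingLevel_congr_points _ ?_ ?_
        · change e (σ • (σ⁻¹ • r)) = P.1
          rw [smul_inv_smul, heP]
        · change e (σ • B.pointsEnd ℂ f' (σ⁻¹ • s)) = AlgPoints.map (B.galConj ℂ σ f').hom.hom.hom Q.1
          rw [k4, pointsMulEquiv_pointsEnd, heQ]

end Galois

/-! ### §2 Descent of the Rosati dual under an equivariant pairing -/

section Descent

variable {K : Type} [Field K] [Algebra K ℂ] (B : AbelianVariety K)
  {ι : Type} [Fintype ι] [DecidableEq ι] {Φ : (ι → ℝ) ≃L[ℝ] (Fin (B.baseChange ℂ).dim → ℂ)}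
  {φ : ComplexTorus Φ → ComplexPoints (B.baseChange ℂ).X}
  (hφ : IsAnalytification (Fin (B.baseChange ℂ).dim → ℂ) (B.baseChange ℂ).X (B.baseChange ℂ).dim φ)
  (hadd : ∀ x y, φ (x + y) = φ x * φ y)

include hφ hadd in
/-- **The Rosati dual of a `K`-rational endomorphism is `Aut(ℂ/K)`-fixed, equivariant-pairing edition**: for an ample `Θ` on `B_ℂ`
with `hΘgal`, a uniformisation `(Φ, φ, p)` of `B_ℂ` whose Appell–Humbert datum of `[𝒪(Θ)^an]` has a Riemann form, and the Rosati dual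
`f′` of `(f₀)_ℂ` (`ρ_r(f′) = d · rosati G ρ_r((f₀)_ℂ)`): `σ • f′ = f′` — both are level adjoints of `d·(f₀)_ℂ` for `ē^Θ` (★
`weilPairingLevel_map_rosatiDual`, §1), and level adjoints are unique (★ `eq_of_forall_weilPairingLevel_map_eq`).
[cite: MumfordAV1970, §20 (p. 186, property (3) of e_n) and §21 Thm. 1] [cite: Milne1986AbelianVarieties, §16 (p. 131) and §17]
[cite: Shimura1998, §5.1 Prop. 5 (p. 38) and §1.3 (the involution of a polarised abelian variety)] -/
theorem galConj_rosatiDual_eq_of_galEquivariant {Θ : CartierDivisor (B.baseChange ℂ).X.left} (hΘ : Θ.IsAmple)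
    (hΘgal : ∀ (σ : ℂ ≃ₐ[K] ℂ) {N : ℕ} [IsDominant (Hom.toSchemeHom ((N : ℤ) • 𝟙 (B.baseChange ℂ)))] {r s : B.Points ℂ}
      (hr : r ^ N = 1) (hs : s ^ N = 1),
      (B.baseChange ℂ).weilPairingLevel Θ (B.torsionPt ℂ (B.smul_pow_eq_one ℂ σ hr)) (B.torsionPt ℂ (B.smul_pow_eq_one ℂ σ hs)) =
        σ ((B.baseChange ℂ).weilPairingLevel Θ (B.torsionPt ℂ hr) (B.torsionPt ℂ hs)))
    (p : AHData Φ) (hp : AHData.toPic p = picClass (cartierDivisorLineBundle hφ Θ))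
    (hR : IsRiemannForm Φ p.form) {G : Matrix ι ι ℚ} (hG : G.map (Rat.cast : ℚ → ℝ) = latticeGram Φ p.form)
    (f₀ : End B) {f' : End (B.baseChange ℂ)} {d : ℤ}
    (hff' : ((endToEndAlgRat hφ hadd f' : endAlgRat Φ) : Matrix ι ι ℚ) =
      d • rosati G ((endToEndAlgRat hφ hadd (Hom.baseChange ℂ f₀ : End (B.baseChange ℂ)) : endAlgRat Φ) :
        Matrix ι ι ℚ))
    (σ : ℂ ≃ₐ[K] ℂ) : B.galConj ℂ σ f' = f' := by
  have hadj : ∀ (N : ℕ) [IsDominant (Hom.toSchemeHom ((N : ℤ) • 𝟙 (B.baseChange ℂ)))]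
      (P Q : (B.baseChange ℂ).torsionPoints ℂ N),
      (B.baseChange ℂ).weilPairingLevel Θ
          ⟨AlgPoints.map (d • (Hom.baseChange ℂ f₀ : End (B.baseChange ℂ))).hom.hom.hom P.1,
            map_mem_torsionPoints _ P.2⟩ Q =
        (B.baseChange ℂ).weilPairingLevel Θ P
          ⟨AlgPoints.map f'.hom.hom.hom Q.1, map_mem_torsionPoints f' Q.2⟩ :=
    fun N _ P Q => weilPairingLevel_map_rosatiDual hφ hadd Θ p hp hR hG hff' P Q
  refine eq_of_forall_weilPairingLevel_map_eq hφ hadd hΘ fun k _ P Q => ?_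
  rw [← B.weilPairingLevel_map_galConj_of_forall_of_galEquivariant Θ hΘgal f₀ d hadj σ _ P Q, hadj]

include hφ hadd in
/-- **The Rosati involution (of `Θ`) preserves `K`-rational endomorphisms, equivariant-pairing edition**: for every `f₀ ∈ End(B)` there
are `d ∈ ℤ ∖ 0` and `f′₀ ∈ End(B)` over `K` with `ρ_r((f′₀)_ℂ) = d · rosati G ρ_r((f₀)_ℂ)` (`K ⊆ ℂ` countable): the Rosati dual of
`(f₀)_ℂ` (★ `exists_rosatiDual`) is `Aut(ℂ/K)`-fixed (§2), hence descends (★ `exists_baseChange_eq_of_forall_galConj_eq_complex`).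
[cite: Shimura1998, §5.1 Prop. 5 (p. 38) and §18.4 (18.4b) (p. 123)] [cite: MumfordAV1970, §20 (p. 189, the Rosati involution) and §21 Thm. 1]
[cite: Milne1986AbelianVarieties, §17 (the Rosati involution)] -/
theorem exists_baseChange_eq_rosatiDual_of_galEquivariant (hK : #K ≤ ℵ₀) {Θ : CartierDivisor (B.baseChange ℂ).X.left}
    (hΘ : Θ.IsAmple)
    (hΘgal : ∀ (σ : ℂ ≃ₐ[K] ℂ) {N : ℕ} [IsDominant (Hom.toSchemeHom ((N : ℤ) • 𝟙 (B.baseChange ℂ)))] {r s : B.Points ℂ}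
      (hr : r ^ N = 1) (hs : s ^ N = 1),
      (B.baseChange ℂ).weilPairingLevel Θ (B.torsionPt ℂ (B.smul_pow_eq_one ℂ σ hr)) (B.torsionPt ℂ (B.smul_pow_eq_one ℂ σ hs)) =
        σ ((B.baseChange ℂ).weilPairingLevel Θ (B.torsionPt ℂ hr) (B.torsionPt ℂ hs)))
    (p : AHData Φ) (hp : AHData.toPic p = picClass (cartierDivisorLineBundle hφ Θ))
    (hR : IsRiemannForm Φ p.form) {G : Matrix ι ι ℚ} (hG : G.map (Rat.cast : ℚ → ℝ) = latticeGram Φ p.form)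
    (f₀ : End B) :
    ∃ (d : ℤ) (f'₀ : End B), d ≠ 0 ∧
      ((endToEndAlgRat hφ hadd (Hom.baseChange ℂ f'₀ : End (B.baseChange ℂ)) : endAlgRat Φ) : Matrix ι ι ℚ) =
        d • rosati G ((endToEndAlgRat hφ hadd (Hom.baseChange ℂ f₀ : End (B.baseChange ℂ)) : endAlgRat Φ) :
          Matrix ι ι ℚ) := by
  obtain ⟨d, f', hd, hff'⟩ := exists_rosatiDual hφ hadd hR hG (Hom.baseChange ℂ f₀ : End (B.baseChange ℂ))
  obtain ⟨f'₀, hf'₀⟩ := B.exists_baseChange_eq_of_forall_galConj_eq_complex hK f'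
    (fun σ => B.galConj_rosatiDual_eq_of_galEquivariant hφ hadd hΘ hΘgal p hp hR hG f₀ hff' σ)
  refine ⟨d, f'₀, hd, ?_⟩
  rw [show (Hom.baseChange ℂ f'₀ : End (B.baseChange ℂ)) = f' from hf'₀]
  exact hff'

end Descent

end Literature.AlgebraicGeometry.Motives.AbelianVariety

/-! ### §3 The Rosati involution of an ample divisor with equivariant pairing is a POSITIVE ANTI-INVOLUTION of `End⁰_K(B)` -/

namespace Literature.AlgebraicGeometry.ComplexMultiplication

open Literature.AlgebraicGeometry.Motives Literature.AlgebraicGeometry.Motives.AbelianVariety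

section Rosati

variable {K : Type} [Field K] [Algebra K ℂ] (B : AbelianVariety K)
  {ι : Type} [Fintype ι] [DecidableEq ι] {Φ : (ι → ℝ) ≃L[ℝ] (Fin (B.baseChange ℂ).dim → ℂ)}
  {φ : ComplexTorus Φ → ComplexPoints (B.baseChange ℂ).X}
  (hφ : IsAnalytification (Fin (B.baseChange ℂ).dim → ℂ) (B.baseChange ℂ).X (B.baseChange ℂ).dim φ)
  (hadd : ∀ x y, φ (x + y) = φ x * φ y)

include hφ hadd in
/-- **The Rosati involution of an AMPLE divisor `Θ` on `B_ℂ` with `Aut(ℂ/K)`-EQUIVARIANT level pairings is a POSITIVE ANTI-INVOLUTION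
of `End⁰_K(B)`** (`K ⊆ ℂ` countable): there is a `ℚ`-linear `τ : End⁰_K(B) → End⁰_K(B)` with `ρ_r((τ y)_ℂ) = rosati G ρ_r(y_ℂ)`
(§2 for every endomorphism), `τ(yz) = τ z · τ y`, `τ(τ y) = y` and `Tr_{End⁰/ℚ}(L_{τ(y)·y}) > 0` for `y ≠ 0` (Mumford §21 Thm. 1
via ★ `leftMulTrace_pos_of_adjoint_repr`) — the proof of ★ `exists_isPositiveAntiInvolution_endAlgebra_of_uniformisation` verbatim with
§2's descent in place of ★ `exists_baseChange_eq_rosatiDual`.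
[cite: MumfordAV1970, §20 (p. 189, the Rosati involution) and §21 Thm. 1] [cite: Shimura1998, §1.3 and §5.1 Proposition 5 (p. 38)]
[cite: Lange2023AbelianVarietiesComplex, §2.4.1 Lemma 2.4.1 and Theorem 2.4.9 (pp. 113–116)] -/
theorem exists_isPositiveAntiInvolution_endAlgebra_of_uniformisation_of_galEquivariant (hK : #K ≤ ℵ₀)
    {Θ : CartierDivisor (B.baseChange ℂ).X.left} (hΘ : Θ.IsAmple)
    (hΘgal : ∀ (σ : ℂ ≃ₐ[K] ℂ) {N : ℕ} [IsDominant (Hom.toSchemeHom ((N : ℤ) • 𝟙 (B.baseChange ℂ)))] {r s : B.Points ℂ}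
      (hr : r ^ N = 1) (hs : s ^ N = 1),
      (B.baseChange ℂ).weilPairingLevel Θ (B.torsionPt ℂ (B.smul_pow_eq_one ℂ σ hr)) (B.torsionPt ℂ (B.smul_pow_eq_one ℂ σ hs)) =
        σ ((B.baseChange ℂ).weilPairingLevel Θ (B.torsionPt ℂ hr) (B.torsionPt ℂ hs)))
    (p : AHData Φ) (hp : AHData.toPic p = picClass (cartierDivisorLineBundle hφ Θ))
    (hR : IsRiemannForm Φ p.form) {G : Matrix ι ι ℚ} (hG : G.map (Rat.cast : ℚ → ℝ) = latticeGram Φ p.form) :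
    ∃ τ : B.endAlgebra →ₗ[ℚ] B.endAlgebra, IsPositiveAntiInvolution B.endAlgebra τ ∧
      ∀ y : B.endAlgebra,
        ((endAlgebraEquivOfAnalytification hφ hadd (endAlgebraBaseChange ℂ B (τ y)) : endAlgRat Φ) : Matrix ι ι ℚ) =
          rosati G ((endAlgebraEquivOfAnalytification hφ hadd (endAlgebraBaseChange ℂ B y) : endAlgRat Φ) : Matrix ι ι ℚ) := by
  classical
  set e := endAlgebraEquivOfAnalytification hφ hadd with he
  -- the rational representation `ψ : End⁰_K(B) → M_ι(ℚ)` of `B_ℂ`, an injective `ℚ`-algebra homomorphism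
  let ψ : B.endAlgebra →ₐ[ℚ] Matrix ι ι ℚ := ((endAlgRat Φ).val.comp e.toAlgHom).comp (endAlgebraBaseChange ℂ B)
  have hψ : ∀ y, ψ y = ((e (endAlgebraBaseChange ℂ B y)) : Matrix ι ι ℚ) := fun _ => rfl
  have hψmem : ∀ y, ψ y ∈ endAlgRat Φ := fun y => by rw [hψ]; exact (e (endAlgebraBaseChange ℂ B y)).2
  have hψinj : Function.Injective ψ :=
    (Subtype.val_injective.comp e.injective).comp
      (Literature.NumberTheory.ComplexMultiplication.endAlgebraBaseChange_injective B)
  have hGu : IsUnit G.det := isUnit_det_of_map_ratCast hG (isUnit_det_latticeGram Φ hR.1 hR.2.2)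
  have hGt : G.transpose = -G := transpose_eq_neg_of_map_ratCast Φ hG
  -- every `rosati G (ψ y)` is a `ψ y'`
  have hsurj : ∀ y : B.endAlgebra, ∃ y' : B.endAlgebra, ψ y' = rosati G (ψ y) := by
    intro y
    obtain ⟨N, F, hN, hF⟩ := AbelianVariety.endAlgebra.exists_eq_algebraMap_mul_of y
    obtain ⟨d, F', hd, hF'⟩ := B.exists_baseChange_eq_rosatiDual_of_galEquivariant hφ hadd hK hΘ hΘgal p hp hR hG F
    refine ⟨algebraMap ℚ B.endAlgebra ((N : ℚ)⁻¹ * (d : ℚ)⁻¹) * AbelianVariety.endAlgebra.of B F', ?_⟩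
    have h1 : ψ y = (N : ℚ)⁻¹ • ((endToEndAlgRat hφ hadd (Hom.baseChange ℂ F : End (B.baseChange ℂ)) : endAlgRat Φ) :
        Matrix ι ι ℚ) := by
      rw [hψ, hF, map_mul, map_mul, AlgHom.commutes, AlgEquiv.commutes, endAlgebraBaseChange_of,
        endAlgebraEquivOfAnalytification_of, Subalgebra.coe_mul, Subalgebra.coe_algebraMap, Algebra.algebraMap_eq_smul_one,
        smul_one_mul]
    rw [hψ, map_mul, map_mul, AlgHom.commutes, AlgEquiv.commutes, endAlgebraBaseChange_of,
      endAlgebraEquivOfAnalytification_of, Subalgebra.coe_mul, Subalgebra.coe_algebraMap, Algebra.algebraMap_eq_smul_one,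
      smul_one_mul, h1, rosati_smul, hF', ← Int.cast_smul_eq_zsmul ℚ d, smul_smul, mul_assoc,
      inv_mul_cancel₀ (Int.cast_ne_zero.2 hd), mul_one]
  choose τ₀ hτ₀ using hsurj
  have hadd' : ∀ y z, τ₀ (y + z) = τ₀ y + τ₀ z := fun y z =>
    hψinj (by rw [hτ₀, map_add, rosati_add, map_add, hτ₀, hτ₀])
  have hsmul' : ∀ (c : ℚ) y, τ₀ (c • y) = c • τ₀ y := fun c y =>
    hψinj (by rw [hτ₀, map_smul, rosati_smul, map_smul, hτ₀])
  let τ : B.endAlgebra →ₗ[ℚ] B.endAlgebra := { toFun := τ₀, map_add' := hadd', map_smul' := hsmul' }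
  have hτ : ∀ y, ψ (τ y) = rosati G (ψ y) := hτ₀
  refine ⟨τ, ⟨⟨fun y z => hψinj ?_, fun y => hψinj ?_⟩, fun y hy => ?_⟩, fun y => hτ y⟩
  · rw [hτ, map_mul, rosati_mul hGu, map_mul, hτ, hτ]
  · rw [hτ, hτ, rosati_rosati hGu hGt]
  · -- positivity, through the real symmetric form `S = ᵗJ G_ℝ`
    rw [leftMulTrace_apply]
    have hS : ((jMatrix Φ).transpose * latticeGram Φ p.form).PosDef :=
      posDef_transpose_jMatrix_mul_latticeGram Φ hR.1 hR.2.2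
    refine leftMulTrace_pos_of_adjoint_repr ψ hψinj hS τ (fun z => ?_) hy
    have hz : (ψ z).map (Rat.cast : ℚ → ℝ) * jMatrix Φ = jMatrix Φ * (ψ z).map (Rat.cast : ℚ → ℝ) :=
      (mem_endAlgRat_iff Φ _).1 (hψmem z)
    rw [hτ, show (rosati G (ψ z)).map (Rat.cast : ℚ → ℝ) = (rosati G (ψ z)).map (Rat.castHom ℝ) from rfl,
      rosati_map (Rat.castHom ℝ) hGu, Rat.coe_castHom, hG, rosati_eq_symmAdjoint Φ _ hz]


end Rosati

end Literature.AlgebraicGeometry.ComplexMultiplication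

end
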